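import Literature.Geometry.DiscreteGeometry.ThreePointBoundGeneral
import Summits.Ventures.PackingBounds.Energy.TenPointCkFourFacc2
import Summits.Ventures.PackingBounds.Energy.TenPointCkFourFgrp3
import Summits.Ventures.PackingBounds.Energy.TenPointCkFourFblk0
import Summits.Ventures.PackingBounds.Energy.TenPointCkFourFblk1
import Summits.Ventures.PackingBounds.Energy.TenPointCkFourFblk2
import Summits.Ventures.PackingBounds.Energy.TenPointCkFourFblk3
import Summits.Ventures.PackingBounds.Energy.TenPointCkFourFblk4
import Summits.Ventures.PackingBounds.Energy.TenPointCkFourFblk5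
import Summits.Ventures.PackingBounds.Energy.TenPointCkFourFblk6
import HarnessLib

/-!
# `TenPointCkFour`: the tree's factored three-point function `threePointF 4 7 6 dcoKW4 gwKW4` equals the expansion `FexpKW4`

Framing: lottery ticket; floor = certified bounds/negative ranges. Venture `PackingBounds`, cell
`pub-packcert`, energy family E3PT (pub-packcert-energy gen 14; n = 4 kernel route = KERNEL-D6 data route + `threePointF 4`).
-/

noncomputable section

open Finset

namespace Summit.Ventures.PackingBounds.Energy.TenPointCkFour

open Literature.Geometry.DiscreteGeometry Literature.Geometry.DiscreteGeometry.BachocVallentin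

/-- `Σ_{k<7} f k` written out. -/
private theorem sum_range_blocksW4 (f : ℕ → ℝ) : ∑ k ∈ range 7, f k = f 0 + f 1 + f 2 + f 3 + f 4 + f 5 + f 6 := by
  simp [Finset.sum_range_succ]

set_option maxRecDepth 20000 in
set_option maxHeartbeats 400000000 in
/-- The last staged partial sum lands on `FexpKW4` (`ring`). -/
theorem fgrp_top_eqW4 (u v t : ℝ) : Facc2KW4 u v t + Fgrp3KW4 u v t = FexpKW4 u v t := by
  unfold Facc2KW4 Fgrp3KW4 FexpKW4
  ring

/-- The tree's factored three-point function (`ThreePointBoundGeneral.threePointF`, `n = 4`) equals `FexpKW4` (blockwise identities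
`fblk<k>_eq`, staged sums, `linear_combination`). -/
theorem threePointF_eqW4 (u v t : ℝ) : threePointF 4 7 6 dcoKW4 gwKW4 u v t = FexpKW4 u v t := by
  rw [threePointF, sum_range_blocksW4, fblk0_eqW4, fblk1_eqW4, fblk2_eqW4, fblk3_eqW4, fblk4_eqW4, fblk5_eqW4, fblk6_eqW4]
  linear_combination fgrp0_eqW4 u v t + fgrp1_eqW4 u v t + fgrp2_eqW4 u v t + fgrp3_eqW4 u v t + facc1_eqW4 u v t + facc2_eqW4 u v t + fgrp_top_eqW4 u v t

end Summit.Ventures.PackingBounds.Energy.TenPointCkFour
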